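import Summits.Ventures.CertifiedManyBodySolver.Downfold.EmerySecularFormDefect
import Summits.Ventures.CertifiedManyBodySolver.Downfold.EmeryBilayerMirror
import HarnessLib

/-!
# The one-band `t–t′` form defect of the bilinear secular family, II: the four-orbital model with ENERGY-DEPENDENT axial
# admixture — fixed-Fermi-surface reduction to ONE coordinate, nodal invisibility of the axial channel, the linear law

Venture CertifiedManyBodySolver, cell `pub/hubbard-downfold` (stage S1, HUMAN RULINGS D-0096/D-0098), seat hubbard-downfold-mod-4
(technique B); namespace `Summit.Ventures.CertifiedManyBodySolver.Downfold.Emery`. Everything here is PROVED (exact algebra + one chain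
rule). WHAT THIS IS NOT: a statement about any material (no number lives here); `U = 0` one-body kinematics; which Cu-site channel a
material has is NOT decided here. Continues `EmerySecularFormDefect` (§1–§4: the family `secBilin`, implicit velocity, THE FORM-DEFECT
LAW `1 + δ = |W_an/W_node|`, σ instance; the four-orbital member `sec4 = (ε_s − ε)·charCubic + T·axialLin = −det(H₄ − ε)`).

* §5 FOUR-ORBITAL INSTANCE. `dsec4 = −charCubic + (ε_s − ε)·dcharCubic + T·daxialLin` (`hasDerivAt_sec4_eps`, member `dsec4_eq_secBilin`);
  the co-shift acts on the derivative by `dcharCubic(t_pp + a, t_pp′ + a) = dcharCubic + a·daxialLin` (`dcharCubic_coshift`) and not at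
  all on `axialLin` (`axialLin_coshift`). FIXED-FERMI-SURFACE REDUCTION (`sec4_fixedFS`, `dsec4_fixedFS`): split the frozen O–O couplings
  `(t̄_pp, t̄_pp′)` of a σ set into a direct part `(t̄_pp − α, t̄_pp′ − α)` and an axial part `a(ε)` with `a(ε_F) = α`
  (`T = α(ε_s − ε_F)`): the contour at `ε_F` is unchanged for every `(α, ε_s)` and **`W₄ = (ε_s − ε_F)·[dcharCubic(t̄) + a′·axialLin(t̄)]`,
  `a′ = α/(ε_s − ε_F) = t_sp²/(ε_s − ε_F)²`** (`dsec4_eq_W4`) — the `daxialLin` terms cancel identically: at fixed Fermi surface the whole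
  axial energy dependence is ONE coordinate, the admixture SLOPE `a′`, which no Fermi-surface-shape datum can see.
* §6 THE AXIAL CHANNEL IS INVISIBLE AT THE NODE (`axialLin_node_eq_zero`): on the zone diagonal `charCubic(x, x, ε) = 0 ⇒
  axialLin(x, x, ε) = 0` (diagonal factorisation `charCubic_diag` / `axialLin_diag` of `EmeryBilayerMirror`: the a₁ Cu-site channel
  decouples from the b₁ band on the diagonal mirror line) — so the NODAL velocity / scale of a σ set is an exact four-orbital quantity at every `a′`, and along the contour
  `axialLin = axA + axB·s` (`axialLin_on_contour_affine`, `W4_on_contour_affine`). Hence THE ONE-PARAMETER LAW (`formDefect4_linear`):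
  **`W4 a′(an)/W4 a′(node) = dcharCubic(an)/dcharCubic(node) + a′·axialLin(an)/dcharCubic(node)`**, i.e. `1 + δ₄(a′) = (1 + δ_σ̄) + a′·κ` —
  exactly LINEAR, no saturation; inverse `axialSlope_of_formDefect`, monotonicity `formDefect4_mono`. The check / census files
  `EmerySecularFormDefectCheck` / `EmerySecularFormDefect<Tag>` certify `δ_σ̄`, `κ` per typed set and read the cell's DFT one-band form
  defects of record (`OneBandFermiPoints<Tag>`) as admixture slopes.

Sources: three-band model [HybertsenSchluterChristensen1989, Eq. (1)]; four-orbital model, energy-dependent axial channel («ṡ/ḋ»,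
`r ↦ r′`) and the `t, t′, t″` language [AndersenEtAl1995, §6–§7, Eqs. (17)–(21)]; [PavariniEtAl2001, Eqs. (1)–(3)].
-/

noncomputable section

namespace Summit.Ventures.CertifiedManyBodySolver.Downfold.Emery

open Real

/-! ## §5 Four-orbital instance: energy-dependent admixture, the co-shift on the derivative, fixed-Fermi-surface reduction -/

/-- `∂_ε axialLin = 4(Δ + 2ε)(x + y) − 32(t_pp − t_pp′)·xy`. [folklore] -/
def daxialLin (Δ tpp c x y ε : ℝ) : ℝ := 4 * (Δ + 2 * ε) * (x + y) - 32 * (tpp - c) * (x * y)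

/-- `d axialLin/dε = daxialLin`. [folklore] -/
theorem hasDerivAt_axialLin_eps (Δ tpd tpp c x y ε : ℝ) :
    HasDerivAt (fun e => axialLin Δ tpd tpp c x y e) (daxialLin Δ tpp c x y ε) ε := by
  have h : (fun e => axialLin Δ tpd tpp c x y e) =
      fun e => 4 * (e * (Δ + e)) * (x + y) - 64 * tpd ^ 2 * (x * y) - 32 * e * (tpp - c) * (x * y) := by
    funext e; unfold axialLin; ring
  rw [h]
  have h1 := (((hasDerivAt_id' ε).mul ((hasDerivAt_id' ε).const_add Δ)).const_mul 4).mul_const (x + y)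
  have h2 := (((hasDerivAt_id' ε).const_mul 32).mul_const (tpp - c)).mul_const (x * y)
  have := (h1.sub_const (64 * tpd ^ 2 * (x * y))).sub h2
  refine this.congr_deriv ?_
  unfold daxialLin; ring

/-- THE CO-SHIFT ON THE DERIVATIVE: `dcharCubic(t_pp + a, t_pp′ + a) = dcharCubic(t_pp, t_pp′) + a·daxialLin`. [folklore] -/
theorem dcharCubic_coshift (Δ tpd tpp c a x y ε : ℝ) :
    dcharCubic Δ tpd (tpp + a) (c + a) x y ε = dcharCubic Δ tpd tpp c x y ε + a * daxialLin Δ tpp c x y ε := by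
  unfold dcharCubic daxialLin dcA dfsD dfsN; ring

/-- `axialLin` is INVARIANT under the co-shift (it depends on `t_pp − t_pp′` only). [folklore] -/
theorem axialLin_coshift (Δ tpd tpp c a x y ε : ℝ) :
    axialLin Δ tpd (tpp + a) (c + a) x y ε = axialLin Δ tpd tpp c x y ε := by
  unfold axialLin; ring

/-- `daxialLin` is invariant under the co-shift. [folklore] -/
theorem daxialLin_coshift (Δ tpp c a x y ε : ℝ) :
    daxialLin Δ (tpp + a) (c + a) x y ε = daxialLin Δ tpp c x y ε := by
  unfold daxialLin; ring

/-- The energy derivative of `sec4`: `dsec4 = −charCubic + (ε_s − ε)·dcharCubic + T·daxialLin`. [folklore] -/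
def dsec4 (Δ εs tpd tpp c T x y ε : ℝ) : ℝ :=
  -charCubic Δ tpd tpp c x y ε + (εs - ε) * dcharCubic Δ tpd tpp c x y ε + T * daxialLin Δ tpp c x y ε

/-- `d sec4/dε = dsec4`. [folklore] -/
theorem hasDerivAt_sec4_eps (Δ εs tpd tpp c T x y ε : ℝ) :
    HasDerivAt (fun e => sec4 Δ εs tpd tpp c T x y e) (dsec4 Δ εs tpd tpp c T x y ε) ε := by
  unfold sec4
  have h1 := ((hasDerivAt_id' ε).const_sub εs).mul (hasDerivAt_charCubic_eps Δ tpd tpp c x y ε)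
  have h2 := (hasDerivAt_axialLin_eps Δ tpd tpp c x y ε).const_mul T
  refine (h1.add h2).congr_deriv ?_
  unfold dsec4; ring

/-- Derivative coefficients of `sec4` as a member: `dA₄ = −cA + (ε_s − ε)dcA`. [folklore] -/
def dsecA4 (Δ εs ε : ℝ) : ℝ := -cA Δ ε + (εs - ε) * dcA Δ ε
/-- `dD₄ = −fsD + (ε_s − ε)dfsD − T(Δ + 2ε)`. [folklore] -/
def dsecD4 (Δ εs tpd c T ε : ℝ) : ℝ := -fsD Δ tpd c ε + (εs - ε) * dfsD Δ tpd c ε - T * (Δ + 2 * ε)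
/-- `dN₄ = −fsN + (ε_s − ε)dfsN + 2T(t_pp − t_pp′)`. [folklore] -/
def dsecN4 (εs tpd tpp c T ε : ℝ) : ℝ := -fsN tpd tpp c ε + (εs - ε) * dfsN tpp c + 2 * T * (tpp - c)

/-- `dsec4` is the member `(dA₄, dD₄, dN₄)` (so §2's branch lemmas apply to the four-orbital band with `W = dsec4`). [folklore] -/
theorem dsec4_eq_secBilin (Δ εs tpd tpp c T x y ε : ℝ) :
    dsec4 Δ εs tpd tpp c T x y ε = secBilin (dsecA4 Δ εs ε) (dsecD4 Δ εs tpd c T ε) (dsecN4 εs tpd tpp c T ε) x y := by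
  unfold dsec4 dsecA4 dsecD4 dsecN4 secBilin daxialLin
  rw [charCubic_bilinear, dcharCubic_eq_secBilin]
  unfold secBilin; ring

/-- FIXED FERMI SURFACE, I. Split the frozen O–O couplings `(t̄_pp, t̄_pp′)` of a σ set into a direct part `(t̄_pp − α, t̄_pp′ − α)`
and an energy-dependent axial part with `a(ε) = T/(ε_s − ε)` and `T = α(ε_s − ε)` AT the energy `ε`: the four-orbital secular
function at `ε` is `(ε_s − ε)` times the frozen σ cubic — the contour at `ε` (hence the Fermi surface and, by Luttinger counting, the
filling) is the same for EVERY `(α, ε_s)`. [cite: PavariniEtAl2001, Eqs. (1)–(3)] -/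
theorem sec4_fixedFS (Δ εs tpd tpp c α T x y ε : ℝ) (hT : T = α * (εs - ε)) :
    sec4 Δ εs tpd (tpp - α) (c - α) T x y ε = (εs - ε) * charCubic Δ tpd tpp c x y ε := by
  unfold sec4
  have h1 : charCubic Δ tpd (tpp - α) (c - α) x y ε = charCubic Δ tpd tpp c x y ε + (-α) * axialLin Δ tpd tpp c x y ε := by
    rw [← charCubic_coshift]; ring_nf
  have h2 : axialLin Δ tpd (tpp - α) (c - α) x y ε = axialLin Δ tpd tpp c x y ε := by
    rw [← axialLin_coshift Δ tpd (tpp - α) (c - α) α]; ring_nf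
  rw [h1, h2, hT]; ring

/-- FIXED FERMI SURFACE, II — THE ONE-COORDINATE LAW FOR THE ENERGY DERIVATIVE: under the same split, ON the contour
(`charCubic(t̄) = 0` at the point) the four-orbital energy derivative is
`dsec4 = (ε_s − ε)·dcharCubic(t̄) + α·axialLin(t̄)` — the `daxialLin` terms cancel identically; dividing by `ε_s − ε`:
`W₄ ∝ dcharCubic(t̄) + a′·axialLin(t̄)` with the single new coordinate `a′ = α/(ε_s − ε) = t_sp²/(ε_s − ε)²` (the admixture SLOPE).
[cite: AndersenEtAl1995, §7 (energy dependence of the axial channel, «ṡ/ḋ», `r ↦ r′`)] -/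
theorem dsec4_fixedFS (Δ εs tpd tpp c α T x y ε : ℝ) (hT : T = α * (εs - ε)) (hP : charCubic Δ tpd tpp c x y ε = 0) :
    dsec4 Δ εs tpd (tpp - α) (c - α) T x y ε = (εs - ε) * dcharCubic Δ tpd tpp c x y ε + α * axialLin Δ tpd tpp c x y ε := by
  unfold dsec4
  have h1 : charCubic Δ tpd (tpp - α) (c - α) x y ε = charCubic Δ tpd tpp c x y ε + (-α) * axialLin Δ tpd tpp c x y ε := by
    rw [← charCubic_coshift]; ring_nf
  have h2 : dcharCubic Δ tpd (tpp - α) (c - α) x y ε = dcharCubic Δ tpd tpp c x y ε + (-α) * daxialLin Δ tpp c x y ε := by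
    rw [← dcharCubic_coshift]; ring_nf
  have h3 : daxialLin Δ (tpp - α) (c - α) x y ε = daxialLin Δ tpp c x y ε := by
    rw [← daxialLin_coshift Δ (tpp - α) (c - α) α]; ring_nf
  rw [h1, h2, h3, hP, hT]; ring

/-- The energy-derivative profile of the four-orbital family at fixed Fermi surface, per unit `(ε_s − ε)`:
`W4 a′ = dcharCubic(t̄) + a′·axialLin(t̄)`. [folklore] -/
def W4 (Δ tpd tpp c a' x y ε : ℝ) : ℝ := dcharCubic Δ tpd tpp c x y ε + a' * axialLin Δ tpd tpp c x y ε

/-- `dsec4 = (ε_s − ε)·W4 (α/(ε_s − ε))` on the contour (`ε ≠ ε_s`). [folklore] -/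
theorem dsec4_eq_W4 (Δ εs tpd tpp c α T x y ε : ℝ) (hε : εs - ε ≠ 0) (hT : T = α * (εs - ε))
    (hP : charCubic Δ tpd tpp c x y ε = 0) :
    dsec4 Δ εs tpd (tpp - α) (c - α) T x y ε = (εs - ε) * W4 Δ tpd tpp c (α / (εs - ε)) x y ε := by
  rw [dsec4_fixedFS Δ εs tpd tpp c α T x y ε hT hP, W4]
  field_simp

/-! ## §6 The axial channel is invisible at the node; the one-parameter (linear) law -/

/-- **THE AXIAL CHANNEL IS INVISIBLE AT THE NODE.** At a diagonal contour point `(x, x)` of a σ set (`Δ + ε > 0`, `t_pp + t_pp′ ≥ 0`,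
`x ≥ 0`): `axialLin(x, x, ε) = 0` and `2fsN1·x = fsD1` — by the diagonal factorisation `charCubic = (Δ + 4(t_pp′ + t_pp)x + ε)·dQuad`,
`axialLin = 8x·dQuad` of `EmeryBilayerMirror` (the a₁ Cu-site channel decouples from the b₁ band on the diagonal mirror line, the `v²`
node of [AndersenEtAl1995, Eq. (24)]): the nodal Fermi point, nodal velocity and nodal scale of a σ set are EXACT four-orbital
quantities for every admixture slope. [cite: AndersenEtAl1995, §6, Eq. (24)] -/
theorem axialLin_node_eq_zero {Δ tpd tpp c x ε : ℝ} (hΔε : 0 < Δ + ε) (hct : 0 ≤ c + tpp) (hx : 0 ≤ x)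
    (hP : charCubic Δ tpd tpp c x x ε = 0) :
    2 * fsN1 tpd tpp c ε * x = fsD1 Δ ε ∧ axialLin Δ tpd tpp c x x ε = 0 := by
  have hf : 0 < Δ + 4 * (c + tpp) * x + ε := by nlinarith [mul_nonneg hct hx]
  rw [charCubic_diag] at hP
  have hd : dQuad Δ tpd tpp c x ε = 0 := (mul_eq_zero.mp hP).resolve_left hf.ne'
  refine ⟨?_, ?_⟩
  · unfold dQuad at hd
    unfold fsN1 fsD1
    linear_combination (-1 : ℝ) * hd
  · rw [axialLin_diag, hd, mul_zero]

/-- Constant coefficient of `axialLin` along the contour of the frozen set: `axA = −fsN1·cA/fsN`. [folklore] -/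
def axA (Δ tpd tpp c ε : ℝ) : ℝ := -(fsN1 tpd tpp c ε * cA Δ ε / fsN tpd tpp c ε)

/-- Slope of `axialLin` in `s = x + y` along the contour: `axB = 4fsD1 + 4fsD·fsN1/fsN`. [folklore] -/
def axB (Δ tpd tpp c ε : ℝ) : ℝ := 4 * fsD1 Δ ε + 4 * fsD Δ tpd c ε * fsN1 tpd tpp c ε / fsN tpd tpp c ε

/-- ON THE CONTOUR `axialLin = axA + axB·(x + y)`. [folklore] -/
theorem axialLin_on_contour_affine {Δ tpd tpp c x y ε : ℝ} (hN : fsN tpd tpp c ε ≠ 0) (hP : charCubic Δ tpd tpp c x y ε = 0) :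
    axialLin Δ tpd tpp c x y ε = axA Δ tpd tpp c ε + axB Δ tpd tpp c ε * (x + y) := by
  rw [charCubic_eq_secBilin] at hP
  rw [axialLin_eq_secBilin, secBilin_on_contour_affine 0 (-fsD1 Δ ε) (fsN1 tpd tpp c ε) hN hP]
  unfold secWA secWB axA axB; ring

/-- `W4` along the contour: `W4 a′ = (dcharA + a′axA) + (dcharB + a′axB)·(x + y)`. [folklore] -/
theorem W4_on_contour_affine {Δ tpd tpp c x y ε : ℝ} (a' : ℝ) (hN : fsN tpd tpp c ε ≠ 0)
    (hP : charCubic Δ tpd tpp c x y ε = 0) :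
    W4 Δ tpd tpp c a' x y ε = (dcharA Δ tpd tpp c ε + a' * axA Δ tpd tpp c ε)
      + (dcharB Δ tpd tpp c ε + a' * axB Δ tpd tpp c ε) * (x + y) := by
  rw [W4, dcharCubic_eq_affine hN hP, axialLin_on_contour_affine hN hP]; ring

/-- **THE ONE-PARAMETER LAW.** At the node the axial coefficient vanishes, so `W4(node) = dcharCubic(node)` for every `a′` and the
four-orbital form-defect ratio is EXACTLY LINEAR in the admixture slope:
`W4 a′ (antinode)/W4 a′ (node) = dcharCubic(an)/dcharCubic(node) + a′·axialLin(an)/dcharCubic(node)` — no saturation.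
[cite: AndersenEtAl1995, §7] -/
theorem formDefect4_linear {Δ tpd tpp c xn ya ε : ℝ} (a' : ℝ) (hWn : dcharCubic Δ tpd tpp c xn xn ε ≠ 0)
    (hax : axialLin Δ tpd tpp c xn xn ε = 0) :
    W4 Δ tpd tpp c a' 1 ya ε / W4 Δ tpd tpp c a' xn xn ε =
      dcharCubic Δ tpd tpp c 1 ya ε / dcharCubic Δ tpd tpp c xn xn ε
        + a' * (axialLin Δ tpd tpp c 1 ya ε / dcharCubic Δ tpd tpp c xn xn ε) := by
  have hn : W4 Δ tpd tpp c a' xn xn ε = dcharCubic Δ tpd tpp c xn xn ε := by rw [W4, hax, mul_zero, add_zero]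
  rw [hn, W4]
  field_simp

/-- INVERSE: the admixture slope that gives a prescribed four-orbital form-defect ratio `R = 1 + δ`:
`a′ = (R·dcharCubic(node) − dcharCubic(an))/axialLin(an)` (when `axialLin(an) ≠ 0`). [folklore] -/
theorem axialSlope_of_formDefect {Δ tpd tpp c xn ya ε a' R : ℝ} (hWn : dcharCubic Δ tpd tpp c xn xn ε ≠ 0)
    (hax : axialLin Δ tpd tpp c xn xn ε = 0) (hQa : axialLin Δ tpd tpp c 1 ya ε ≠ 0)
    (hR : W4 Δ tpd tpp c a' 1 ya ε / W4 Δ tpd tpp c a' xn xn ε = R) :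
    a' = (R * dcharCubic Δ tpd tpp c xn xn ε - dcharCubic Δ tpd tpp c 1 ya ε) / axialLin Δ tpd tpp c 1 ya ε := by
  have hn : W4 Δ tpd tpp c a' xn xn ε = dcharCubic Δ tpd tpp c xn xn ε := by rw [W4, hax, mul_zero, add_zero]
  rw [hn, W4, div_eq_iff hWn] at hR
  rw [eq_div_iff hQa]
  linarith

/-- MONOTONICITY: the four-orbital form-defect ratio is monotone in the slope `a′` with the sign of `axialLin(an)/dcharCubic(node)`;
in the cuprate regime (both positive) MORE energy dependence of the axial channel ⇒ SLOWER antinode (larger `δ`). [folklore] -/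
theorem formDefect4_mono {Δ tpd tpp c xn ya ε a₁ a₂ : ℝ} (h12 : a₁ ≤ a₂) (hWn : 0 < dcharCubic Δ tpd tpp c xn xn ε)
    (hax : axialLin Δ tpd tpp c xn xn ε = 0) (hQa : 0 ≤ axialLin Δ tpd tpp c 1 ya ε) :
    W4 Δ tpd tpp c a₁ 1 ya ε / W4 Δ tpd tpp c a₁ xn xn ε ≤ W4 Δ tpd tpp c a₂ 1 ya ε / W4 Δ tpd tpp c a₂ xn xn ε := by
  rw [formDefect4_linear a₁ hWn.ne' hax, formDefect4_linear a₂ hWn.ne' hax]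
  have : 0 ≤ axialLin Δ tpd tpp c 1 ya ε / dcharCubic Δ tpd tpp c xn xn ε := div_nonneg hQa hWn.le
  nlinarith

end Summit.Ventures.CertifiedManyBodySolver.Downfold.Emery
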